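import Mathlib
import HarnessLib
import Summits.Ventures.LatticeQCDFlow.Scaling.AR1SwitchingLaw

/-!
# AR1SwitchingEndpoints — the AR(1) switching model at `ρ = 0, 1, −1`, and the ordering at every
# `n_step`: under-relaxation costs, over-relaxation pays, the second law, echo cancellation

HONEST FRAMING: exact (Metropolis-corrected) sampling algorithms for lattice gauge theory;
figures of merit are autocorrelation/cost numbers at stated couplings and volumes; no
continuum-physics claim.

Venture `LatticeQCDFlow` (cell pub-lqcd), topic `Scaling`; FANOUT row 19 (`su2-snf`, GEN-4).
OUR WORK, elementary finite sums; nothing is cited as a fact.  Companion of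
`Scaling/AR1SwitchingLaw` (the model, `ar1MeanWork`, `ar1WorkVar`, the `k′` law): there the
leading-order statements in `1/n_step`; here the statements that hold AT EVERY `n_step`, for the
mean dissipated work `⟨W⟩ = ar1MeanWork ρ d n` of a trap dragged along steps `d` with autoregression
`ρ` between switches (`Var W = 2⟨W⟩` by `ar1WorkVar_eq_two_mul_meanWork`, so every statement below
is also one about `Var W = −log ESS` per degree of freedom).

## Content (all proved)

* §1 ENDPOINTS, every trap path `d`: `ar1MeanWork_rho_zero` (`ρ = 0`, heat bath / perfect
  relaxation: `⟨W⟩ = Σ d_k²/2`, the quasi-static = thermodynamic-length value; row 8's `KL_qs` for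
  this family), `ar1MeanWork_rho_one` (`ρ = 1`, no update: `⟨W⟩ = (Σ d_k)²/2 = (m_n − m_0)²/2`
  whatever `n` — intermediate switches without relaxation buy nothing, cf. row 8's
  `lazyDissipation_one`), `ar1MeanWork_rho_neg_one` (`ρ = −1`, reflection about the new centre:
  `⟨W⟩ = (Σ (−1)^k d_k)²/2`, an ALTERNATING sum), **`ar1MeanWork_rho_neg_one_even`** (uniform
  protocol, `n` even: `⟨W⟩ = 0`, hence `Var W = 0`, constant weights, `ESS = 1` — the ECHO
  counterexample that retired the naive thermodynamic-length floor for general layers,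
  HOME/THEORY-2 C3 v1.5 (`X = ℤ_m`, translated well, reflections), is the `ρ = −1` member of a
  one-parameter solvable family).
* §2 ORDERING AT EVERY `n`: `ar1MeanWork_qs_le` / `ar1MeanWork_mono` (non-negative steps, `ρ ≥ 0`:
  `⟨W⟩ ≥ Σ d_k²/2` and monotone in `ρ` — row 8's lag law `qsDissipation_le_lazyDissipation` /
  `lazyDissipation_mono` in this model); uniform protocol with ANY sign of the step:
  `mul_lagSeq_const_nonneg` / `mul_lagSeq_const_nonpos` (each step does work `δ e_k ≥ 0` against
  the lag when `0 ≤ ρ ≤ 1`, RECOVERS `δ e_k ≤ 0` when `−1 ≤ ρ ≤ 0`), hence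
  **`ar1MeanWork_const_qs_le`** (`0 ≤ ρ ≤ 1`: `n δ²/2 ≤ ⟨W⟩`, under-relaxation costs) and
  **`ar1MeanWork_const_le_qs`** (`−1 ≤ ρ ≤ 0`: `⟨W⟩ ≤ n δ²/2`, over-relaxation PAYS at every `n` —
  outside theory2's dominated classes C3″/C3‴, as it must be: the AR(1) layer with `ρ < 0` is not
  stochastically monotone), and **`ar1MeanWork_const_nonneg`** (the second law inside the model:
  `0 ≤ ⟨W⟩` for every `ρ ∈ [−1, 1]`, every `n`, every step `δ`).

NOT CLAIMED: anything about lattice heat-bath / over-relaxation kernels; which `ρ` a given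
1HB+4OR sweep realises for the defect plaquette is an empirical question (row 19's `k′_W`).
-/

namespace Summit.Ventures.LatticeQCDFlow.Scaling

open Finset
open Summit.Ventures.LatticeQCDFlow.Exactness (lagSeq lagSeq_zero lagSeq_succ lagSeq_eq_sum
  lagSeq_eps_zero lagSeq_eps_one lagSeq_nonneg lagSeq_mono)

/-! ## §1 Endpoints: perfect relaxation, no relaxation, reflection -/

/-- `ρ = 0` (perfect relaxation, heat bath to the new law): no lag, `⟨W⟩ = Σ d_k²/2` — the
quasi-static / thermodynamic-length value. -/
theorem ar1MeanWork_rho_zero (d : ℕ → ℝ) (n : ℕ) :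
    ar1MeanWork 0 d n = ∑ k ∈ range n, d k ^ 2 / 2 := by
  unfold ar1MeanWork
  refine sum_congr rfl fun k _ => ?_
  rw [lagSeq_eps_zero, mul_zero, add_zero]

/-- `ρ = 1` (no relaxation at all): `⟨W⟩ = (Σ_{k<n} d_k)²/2 = (m_n − m_0)²/2` whatever `n` —
intermediate steps without relaxation buy nothing. -/
theorem ar1MeanWork_rho_one (d : ℕ → ℝ) (n : ℕ) :
    ar1MeanWork 1 d n = (∑ k ∈ range n, d k) ^ 2 / 2 := by
  induction n with
  | zero => simp [ar1MeanWork]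
  | succ n ih =>
      rw [ar1MeanWork, sum_range_succ, ← ar1MeanWork, ih, lagSeq_eps_one, sum_range_succ]
      ring

/-- `ρ = −1` (deterministic reflection about the new trap centre, the extreme over-relaxation):
`⟨W⟩ = (Σ_{k<n} (−1)^k d_k)²/2`, an ALTERNATING sum — successive steps cancel. -/
theorem ar1MeanWork_rho_neg_one (d : ℕ → ℝ) (n : ℕ) :
    ar1MeanWork (-1) d n = (∑ k ∈ range n, (-1) ^ k * d k) ^ 2 / 2 := by
  induction n with
  | zero => simp [ar1MeanWork]
  | succ n ih =>
      rw [ar1MeanWork, sum_range_succ, ← ar1MeanWork, ih, lagSeq_eq_sum, sum_range_succ]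
      have h : ∑ i ∈ range n, (-1 : ℝ) ^ (n - i) * d i = (-1) ^ n * ∑ i ∈ range n, (-1) ^ i * d i := by
        rw [mul_sum]
        refine sum_congr rfl fun i hi => ?_
        have hle := (mem_range.mp hi).le
        have : (-1 : ℝ) ^ n = (-1) ^ (n - i) * (-1) ^ i := by
          rw [← pow_add, Nat.sub_add_cancel hle]
        rw [this]
        have h2 : ((-1 : ℝ) ^ i) * (-1) ^ i = 1 := by
          rw [← pow_add, ← two_mul, pow_mul]; simp
        calc (-1 : ℝ) ^ (n - i) * d i = (-1) ^ (n - i) * ((-1) ^ i * (-1) ^ i) * d i := by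
              rw [h2, mul_one]
          _ = (-1) ^ (n - i) * (-1) ^ i * ((-1) ^ i * d i) := by ring
      rw [h]
      have hsq : ((-1 : ℝ) ^ n) ^ 2 = 1 := by rw [← pow_mul, mul_comm, pow_mul]; simp
      nlinarith [hsq]


/-- Uniform protocol, `n` even, `ρ = −1`: the reflections cancel in pairs and `⟨W⟩ = 0`, `Var W = 0`
— weights constant, `ESS = 1`: the echo counterexample that retired the naive thermodynamic-length
floor (HOME/THEORY-2 C3, v1.5) is the `ρ = −1` member of the family. -/
theorem ar1MeanWork_rho_neg_one_even (δ : ℝ) {n : ℕ} (hn : Even n) :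
    ar1MeanWork (-1) (fun _ => δ) n = 0 := by
  rw [ar1MeanWork_rho_neg_one]
  obtain ⟨m, rfl⟩ := hn
  have h : ∀ m : ℕ, ∑ k ∈ range (m + m), (-1 : ℝ) ^ k * δ = 0 := by
    intro m
    induction m with
    | zero => simp
    | succ m ih =>
        rw [show m + 1 + (m + 1) = m + m + 1 + 1 by ring, sum_range_succ, sum_range_succ, ih,
          pow_succ, show m + m = 2 * m by ring, pow_mul]
        simp
  rw [h]
  simp

/-! ## §2 Ordering at every `n`: under-relaxation costs, over-relaxation pays -/

/-- Under-relaxation costs (row 8's lag law, this model): for `ρ ≥ 0` and non-negative steps the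
mean dissipation is at least the quasi-static value `Σ d_k²/2`. -/
theorem ar1MeanWork_qs_le {ρ : ℝ} (h0 : 0 ≤ ρ) {d : ℕ → ℝ} (hd : ∀ k, 0 ≤ d k) (n : ℕ) :
    ∑ k ∈ range n, d k ^ 2 / 2 ≤ ar1MeanWork ρ d n := by
  unfold ar1MeanWork
  refine sum_le_sum fun k _ => ?_
  have := mul_nonneg (hd k) (lagSeq_nonneg h0 hd k)
  linarith

/-- More autocorrelation, more dissipation: `⟨W⟩` is monotone in `ρ ∈ [0, 1]` along non-negative
steps. -/
theorem ar1MeanWork_mono {ρ ρ' : ℝ} (h0 : 0 ≤ ρ) (h : ρ ≤ ρ') {d : ℕ → ℝ} (hd : ∀ k, 0 ≤ d k)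
    (n : ℕ) : ar1MeanWork ρ d n ≤ ar1MeanWork ρ' d n := by
  unfold ar1MeanWork
  refine sum_le_sum fun k _ => ?_
  have := mul_le_mul_of_nonneg_left (lagSeq_mono h0 h hd k) (hd k)
  linarith

/-- Constant steps, `0 ≤ ρ ≤ 1`: every step does non-negative work against the lag,
`0 ≤ δ·e_k` (whatever the sign of `δ`). -/
theorem mul_lagSeq_const_nonneg {ρ : ℝ} (h0 : 0 ≤ ρ) (h1 : ρ ≤ 1) (δ : ℝ) (k : ℕ) :
    0 ≤ δ * lagSeq ρ (fun _ => δ) k := by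
  rcases h1.eq_or_lt with rfl | hlt
  · rw [lagSeq_eps_one]
    simp only [sum_const, card_range, nsmul_eq_mul]
    nlinarith [sq_nonneg δ, (k.cast_nonneg : (0 : ℝ) ≤ k)]
  · have hk := lagSeq_const_mul ρ δ k
    have hpos : 0 < 1 - ρ := sub_pos.mpr hlt
    have hpow : ρ ^ k ≤ 1 := pow_le_one₀ h0 h1
    have key : (1 - ρ) * (δ * lagSeq ρ (fun _ => δ) k) = δ ^ 2 * (ρ * (1 - ρ ^ k)) := by
      rw [mul_left_comm, hk]; ring
    refine le_of_mul_le_mul_left ?_ hpos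
    rw [mul_zero, key]
    exact mul_nonneg (sq_nonneg δ) (mul_nonneg h0 (sub_nonneg.mpr hpow))

/-- Constant steps, `−1 ≤ ρ ≤ 0`: every step RECOVERS work from the (overshooting) lag,
`δ·e_k ≤ 0`. -/
theorem mul_lagSeq_const_nonpos {ρ : ℝ} (h0 : ρ ≤ 0) (h1 : -1 ≤ ρ) (δ : ℝ) (k : ℕ) :
    δ * lagSeq ρ (fun _ => δ) k ≤ 0 := by
  have hk := lagSeq_const_mul ρ δ k
  have hpos : 0 < 1 - ρ := by linarith
  have hpow : ρ ^ k ≤ 1 := by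
    calc ρ ^ k ≤ |ρ ^ k| := le_abs_self _
      _ = |ρ| ^ k := abs_pow ρ k
      _ ≤ 1 := pow_le_one₀ (abs_nonneg ρ) (abs_le.mpr ⟨by linarith, by linarith⟩)
  have key : (1 - ρ) * (δ * lagSeq ρ (fun _ => δ) k) = δ ^ 2 * (ρ * (1 - ρ ^ k)) := by
    rw [mul_left_comm, hk]; ring
  refine le_of_mul_le_mul_left ?_ hpos
  rw [mul_zero, key]
  exact mul_nonpos_of_nonneg_of_nonpos (sq_nonneg δ)
    (mul_nonpos_of_nonpos_of_nonneg h0 (sub_nonneg.mpr hpow))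

/-- Under-relaxation costs, uniform protocol: for `0 ≤ ρ ≤ 1`, `n δ²/2 ≤ ⟨W⟩`. -/
theorem ar1MeanWork_const_qs_le {ρ : ℝ} (h0 : 0 ≤ ρ) (h1 : ρ ≤ 1) (δ : ℝ) (n : ℕ) :
    n * δ ^ 2 / 2 ≤ ar1MeanWork ρ (fun _ => δ) n := by
  rw [ar1MeanWork_const, mul_sum]
  have := sum_nonneg fun k (_ : k ∈ range n) => mul_lagSeq_const_nonneg h0 h1 δ k
  linarith

/-- Over-relaxation pays, at every `n` (uniform protocol): for `−1 ≤ ρ ≤ 0` the anti-correlated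
layers dissipate LESS than perfect relaxation, `⟨W⟩ ≤ n δ²/2`. -/
theorem ar1MeanWork_const_le_qs {ρ : ℝ} (h0 : ρ ≤ 0) (h1 : -1 ≤ ρ) (δ : ℝ) (n : ℕ) :
    ar1MeanWork ρ (fun _ => δ) n ≤ n * δ ^ 2 / 2 := by
  rw [ar1MeanWork_const, mul_sum]
  have := sum_nonpos fun k (_ : k ∈ range n) => mul_lagSeq_const_nonpos h0 h1 δ k
  linarith

/-- The second law inside the model, uniform protocol, every `ρ ∈ [−1, 1]`: `0 ≤ ⟨W⟩`. -/
theorem ar1MeanWork_const_nonneg {ρ : ℝ} (h1 : -1 ≤ ρ) (h2 : ρ ≤ 1) (δ : ℝ) (n : ℕ) :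
    0 ≤ ar1MeanWork ρ (fun _ => δ) n := by
  rcases le_or_gt 0 ρ with h0 | h0
  · exact le_trans (by positivity) (ar1MeanWork_const_qs_le h0 h2 δ n)
  · -- `(1 − ρ)² ⟨W⟩ = n δ²(1 − ρ²)/2 − δ² ρ (1 − ρ^n) ≥ 0` and `(1 − ρ)² > 0`
    have h := ar1MeanWork_const_mul ρ δ n
    have hpos : 0 < (1 - ρ) ^ 2 := by nlinarith
    have hpow : ρ ^ n ≤ 1 := by
      calc ρ ^ n ≤ |ρ ^ n| := le_abs_self _
        _ = |ρ| ^ n := abs_pow ρ n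
        _ ≤ 1 := pow_le_one₀ (abs_nonneg ρ) (abs_le.mpr ⟨by linarith, by linarith⟩)
    have hrhs : 0 ≤ n * δ ^ 2 * (1 - ρ ^ 2) / 2 - δ ^ 2 * ρ * (1 - ρ ^ n) := by
      have h3 : 0 ≤ 1 - ρ ^ 2 := by nlinarith
      have hA : 0 ≤ (n : ℝ) * δ ^ 2 * (1 - ρ ^ 2) / 2 :=
        div_nonneg (mul_nonneg (mul_nonneg n.cast_nonneg (sq_nonneg δ)) h3) zero_le_two
      have hB : δ ^ 2 * ρ * (1 - ρ ^ n) ≤ 0 := by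
        rw [mul_assoc]
        exact mul_nonpos_of_nonneg_of_nonpos (sq_nonneg δ)
          (mul_nonpos_of_nonpos_of_nonneg h0.le (sub_nonneg.mpr hpow))
      linarith
    refine le_of_mul_le_mul_left ?_ hpos
    rw [mul_zero, h]
    exact hrhs

end Summit.Ventures.LatticeQCDFlow.Scaling
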